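import Summits.BirchSwinnertonDyer.BirchSwinnertonDyer.Theorems.PrintCf2SplitBadTwoLayerDualShapiroReading
import Summits.BirchSwinnertonDyer.BirchSwinnertonDyer.Theorems.PrintCf2SplitBadTwoKummerProNullDischarge
import Summits.BirchSwinnertonDyer.BirchSwinnertonDyer.Theorems.PrintCf2SplitBadTwoKummerUClassLevel
import Summits.BirchSwinnertonDyer.Rank1Residual.GaloisImage.TorsionLevelTwoDevissageLocal
import HarnessLib

/-!
# Crux `PrintCf2.SplitBadTwoRankOneOfFacts` (stmt-BirchSwinnertonDyer-20368), skeleton v13.4, (REG₂) `stub_xRegular_two` FACT-FREE road, R2 brick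
# **B5-U (the `v̄` reading in `U`-currency), FILE 1: THE NORM TRICK** — the dual-of-unramified condition at `v̄` of the dual-Shapiro class of a
# layer class `y′ ∈ H¹(U, M′)` forces `n ∣ ord_v̄ (N_{F/K} b)` for the Kummer element `b ∈ F` of `y′`, WITHOUT any local invariant on an open
# subgroup of `Γ_{K_v̄}`

Cell `bsd-print-cf2`, EXTRA WIDTH seat `bsd-line-cf2-p1-w3` g14 (prover-bsd-line-cf2-p1-w3-g14-0); `--supports stmt-BirchSwinnertonDyer-20368`
(helper, Theses-free). HONEST FRAMING: nothing here closes the crux or a registered stub; BSD is not proved by any of this; no summit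
statement is proved by this seat. No definition, no named fact, no `sorry`. UNCONDITIONAL.

WHY (`Cruxes/SplitBadTwoRankOneOfFacts/R2-BRICKS-w5g7.md` §3 B5 / §5; -w8 g5 file 6b `…LayerDualShapiroReading` p705484, STATUS 07:15:15Z).
-w8 g5's `dualPullback_eq_zero_of_layerProNull` turns B2c's `hkill` into (PRO-NULL) in the line's currency, with ONE clause left DISPLAYED at `v̄ ∣ n`:
«the localisation at `v̄` of the dual-Shapiro class `H¹(Ψ)(Sh y′)` lies in the canonical dual local condition of `H¹_ur(K_v̄, Maps(Γ_K ⧸ U, M))`»;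
-w3 g13's class-level (PRO-NULL)_U `KummerU.exists_level_resH1Hom_eq_zero_of_local` (p703858) wants instead «`p^M ∣ ord_{w′}(b)` at every place
`w′ ∣ v̄` of `F = K̄^U`» for the Kummer element `b` of `y′`. The obvious reading (Mackey at `v̄` + the local invariant of the layer completion `F_{w′}`,
an open subgroup of `Γ_{K_v̄}`) needs an `inv` the tree does not have. THE NORM TRICK avoids it:
* §1 `localMap_tateDualComap_mem_dualLocalCondition_unramified` — the condition «pairs to zero with the unramified classes» pulls back along ANY
  equivariant `c : V → Maps(Γ_K ⧸ U, M)` (`⟨H¹(c) a, Y⟩ = ⟨a, H¹(c^D) Y⟩`, `localTatePairingZMod_localMap_left`; `H¹(c)` preserves `H¹_ur`);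
* §2 `exists_constIntertwining` — the CONSTANTS `c : ℤ/n → Maps(Γ_K ⧸ U, M)`, `k ↦ (y ↦ k • m₀)` at a `Γ_K`-fixed `m₀` (`n • m₀ = 0`), from the
  TRIVIAL module `ℤ/n` — so the pulled-back condition is a condition over the BASE `K` on the class `H¹(c^D) H¹(Ψ) Sh y′ ∈ H¹(K, (ℤ/n)^D)`;
* §3 `prod_smul_eq_algebraMap_norm` — orbit product = norm: `∏_{y ∈ Γ_K⧸U} s_y • b = N_{F/K}(b)` (`F/K` Galois, `U = Gal(K̄/F)`);
* §4 **`map_eval_tateDualComap_dualShapiro_eq_kummerMap_norm`** — that class, evaluated at `1` (`e : (ℤ/n)^D → μₙ`), IS the Kummer class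
  `κₙ(N_{F/K} b)`: on cocycles `Σ_y B(m₀, Sh φ(g)(y)) = g(Nβ)/Nβ`, `Nβ = ∏_y s_y β`, `(Nβ)ⁿ = N_{F/K}(b)` (the fibre sum of the Shapiro lift is
  the transfer; the Kummer class depends only on the `n`-th power, `kummerClassHom_eq_of_pow_eq`) — `cor ∘ Kummer = Kummer ∘ norm`;
* §5 **`dvd_log_valuation_norm_of_dualShapiro_mem`** — hence the displayed `v̄`-clause gives `(n : ℤ) ∣ log v_v̄(N_{F/K} b)` by -w7 g6's (K-ū)
  reading AT THE BASE `KummerProNull.dvd_log_valuation_of_mem_dualLocalCondition_unramifiedSubgroup` (p701967).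
FILE 2 (`…NormAtVbarTotallyRamified`) turns `ord_v̄(N_{F/K} b)` into `ord_{w′}(b)` at the (unique, totally ramified) place `w′ ∣ v̄` of the
layers `F = K*_m` (`I_v̄ · U = Γ_K`, -w2 g13 `DoublyAdaptedPair.exists_mem_inertia_apply_eq_of_isUnramifiedOutside`), landing EXACTLY on the
`(v̄)` hypothesis of p703858. presearch: «corestriction Kummer class norm», «Shapiro lemma local Tate pairing induced module» → NSW (1.5.3)(iv),
(1.6.4)–(1.6.5) (`cor` is induced by the norm of the induced module; `H¹(L, μₙ) = Lˣ/n` and `cor = N_{L/K}`), Serre *Local Fields* VII §7, X §3 b);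
[corpus: no statement of the `v̄`-reading in this form — folklore plumbing]; no new fact. beyond-print theorem: no.

References: [NeukirchSchmidtWingberg2008] I §4 (1.4.2), I §5 Prop. (1.5.3)(iv), I §6 Prop. (1.6.4)–(1.6.5); [SerreLocalFields1979] VII §6–§7,
X §3 b), XIV §1 Prop. 3; [MilneADT2006] I §0, §2 (Thm. 2.6); [NeukirchANT1999] Ch. IV §1; [Howard2004HeegnerKolyvagin] Def. 2.1.6.
-/

noncomputable section

open scoped Classical ContRepresentation

set_option linter.dupNamespace false
set_option autoImplicit false

open CategoryTheory NumberField IsDedekindDomain Field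
open Literature.NumberTheory.EllipticCurves Literature.NumberTheory.EllipticCurves.GreenbergSelmer
open Literature.NumberTheory.EllipticCurves.GreenbergVatsal2000
open Literature.NumberTheory.GaloisRepresentations Literature.NumberTheory.GaloisRepresentations.LocalWeilDatum
open Literature.NumberTheory.GaloisRepresentations.DiscreteGaloisModule (SelmerStructure mu MuCarrier TateDual tateDual
  coindTateDualMor coindTateDualHom unramifiedSubgroup localMap)
open Literature.NumberTheory.GaloisCohomology
open Summit.BirchSwinnertonDyer.Rank1Residual.X11b.LocBridge
open Summit.BirchSwinnertonDyer.Rank1Residual.GaloisImage.Transport (tateDualComap tateDualComap_apply_apply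
  localTatePairingZMod_localMap_left)
open Summit.BirchSwinnertonDyer.Rank1Residual.GaloisImage.CoreRankZero (localization_map_one_eq)
open Summit.BirchSwinnertonDyer.Rank1Residual.GaloisImage.KSDevissage (localMap_mem_unramifiedSubgroup)

namespace Summit.BirchSwinnertonDyer.BirchSwinnertonDyer.Theorems.PrintCf2.NormAtVbar

/-! ## §1. The dual-of-unramified condition pulls back along ANY equivariant map into the coinduced module -/

section Pullback

variable {K : Type} [Field K] [NumberField K] {n : ℕ}

/-- **Functoriality of the dual local condition «orthogonal to the unramified classes».** For any equivariant map
`c : V → W` of finite discrete `Γ_K`-modules, any family of local invariant maps and any finite place `w`: if `Y ∈ H¹(K_w, W^D)` pairs to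
zero with `H¹_ur(K_w, W)`, then `H¹(c^D) Y ∈ H¹(K_w, V^D)` pairs to zero with `H¹_ur(K_w, V)` (adjointness `⟨H¹(c) a, Y⟩_w = ⟨a, H¹(c^D) Y⟩_w`,
`localTatePairingZMod_localMap_left`, and `H¹(c)` preserves unramified classes). [cite: NeukirchSchmidtWingberg2008, I §4 (1.4.2)]
[cite: Howard2004HeegnerKolyvagin, Def. 2.1.6 (arXiv:1202.6340 p. 5)] -/
theorem localMap_tateDualComap_mem_dualLocalCondition_unramified
    {V W : Type} [AddCommGroup V] [TopologicalSpace V] [DiscreteTopology V] [Finite V]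
    [AddCommGroup W] [TopologicalSpace W] [DiscreteTopology W] [Finite W]
    {ρV : DiscreteGaloisModule K V} {ρW : DiscreteGaloisModule K W}
    (c : ρV.toContRepresentation →ⁱL ρW.toContRepresentation) (inv : LocalInvariants K n) (w : HeightOneSpectrum (𝓞 K))
    {Y : galoisCohomology ((ρW.tateDual n).toLocal (Sum.inr w)) 1}
    (hY : Y ∈ inv.dualLocalCondition ρW (Sum.inr w) (unramifiedSubgroup (GaloisRep.toLocal w ρW) 1)) :
    localMap (tateDualComap c) (Sum.inr w) Y ∈
      inv.dualLocalCondition ρV (Sum.inr w) (unramifiedSubgroup (GaloisRep.toLocal w ρV) 1) := by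
  rw [LocalInvariants.mem_dualLocalCondition_iff] at hY ⊢
  intro a ha
  rw [← localTatePairingZMod_localMap_left c (tateDualComap c) (fun _ _ ↦ rfl)]
  exact hY _ (localMap_mem_unramifiedSubgroup c w ha)

end Pullback

/-! ## §2. The constants of the coinduced module: `ℤ/n → Maps(Γ_K ⧸ U, M)`, `k ↦ (y ↦ k • m₀)` for a `Γ_K`-fixed `m₀` -/

section Constants

variable {K : Type} [Field K] {M : Type} [AddCommGroup M] [TopologicalSpace M] [DiscreteTopology M]
  (ρ : DiscreteGaloisModule K M) (U : Subgroup (absoluteGaloisGroup K)) [Fintype (absoluteGaloisGroup K ⧸ U)]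
  (hU : IsOpen (U : Set (absoluteGaloisGroup K))) {n : ℕ}

/-- **The constant maps `ℤ/n → Maps(Γ_K ⧸ U, M)`, `k ↦ (y ↦ k • m₀)`**, for a `Γ_K`-FIXED `m₀ ∈ M` with `n • m₀ = 0`, form a continuous
`Γ_K`-intertwining map from the TRIVIAL module `ℤ/n` (`(g ⋆ const_m)(y) = g • m = const_m`). [cite: NeukirchSchmidtWingberg2008, I §6] -/
theorem exists_constIntertwining (ρ₁ : DiscreteGaloisModule K (ZMod n)) (hρ₁ : ∀ (σ : absoluteGaloisGroup K) (k : ZMod n), ρ₁ σ k = k)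
    (m₀ : M) (hm₀ : ∀ σ : absoluteGaloisGroup K, ρ σ m₀ = m₀) (hn : n • m₀ = 0) :
    ∃ c : ρ₁.toContRepresentation →ⁱL (ρ.coind U hU).toContRepresentation, ∀ y : absoluteGaloisGroup K ⧸ U, c 1 y = m₀ := by
  let f₀ : { f : ℤ →+ M // f n = 0 } := ⟨zmultiplesHom M m₀, by
    change (n : ℤ) • m₀ = 0
    rw [natCast_zsmul, hn]⟩
  let f : ZMod n →+ M := ZMod.lift n f₀
  let cf : ZMod n →+ (absoluteGaloisGroup K ⧸ U → M) :=
    { toFun := fun k _ ↦ f k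
      map_zero' := funext fun _ ↦ f.map_zero
      map_add' := fun a b ↦ funext fun _ ↦ f.map_add a b }
  refine ⟨{ toContinuousLinearMap := ⟨cf.toIntLinearMap, continuous_of_discreteTopology⟩
            isIntertwining' := fun σ ↦ ContinuousLinearMap.ext fun k ↦ funext fun y ↦ ?_ }, fun y ↦ ?_⟩
  · change f (ρ₁ σ k) = (ρ.coind U hU) σ (fun _ ↦ f k) y
    rw [hρ₁, DiscreteGaloisModule.coind_apply_apply]
    -- `f k` is a multiple of `m₀`, fixed by `σ`
    obtain ⟨z, rfl⟩ := ZMod.intCast_surjective k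
    rw [ZMod.lift_coe]
    change z • m₀ = ρ σ (z • m₀)
    rw [map_zsmul, hm₀]
  · change f 1 = m₀
    rw [show (1 : ZMod n) = ((1 : ℤ) : ZMod n) from Int.cast_one.symm, ZMod.lift_coe]
    exact one_zsmul m₀

end Constants

/-! ## §3. Orbit product = norm for a finite Galois `F ⊆ K̄` -/

section Norm

variable {K : Type} [Field K] (F : IntermediateField K (AlgebraicClosure K)) [FiniteDimensional K F] [IsGalois K F]
  [Fintype (absoluteGaloisGroup K ⧸ galFixing K F)]
  {s : absoluteGaloisGroup K ⧸ galFixing K F → absoluteGaloisGroup K} (hs : ∀ y, (s y : absoluteGaloisGroup K ⧸ galFixing K F) = y)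

include hs in
/-- **Orbit product = norm.** For a finite Galois `F ⊆ K̄` over `K` and representatives `s` of `Γ_K ⧸ Gal(K̄/F)`:
`∏_y s(y) • b = N_{F/K}(b)` in `K̄` (`Algebra.norm_eq_prod_automorphisms` and `Γ_K ⧸ Gal(K̄/F) ≅ Gal(F/K)` via restriction).
[cite: NeukirchANT1999, Ch. IV §1] -/
theorem prod_smul_eq_algebraMap_norm (b : F) :
    ∏ y : absoluteGaloisGroup K ⧸ galFixing K F, (s y) • (b : AlgebraicClosure K) =
      algebraMap K (AlgebraicClosure K) (Algebra.norm K b) := by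
  have hprod := Algebra.norm_eq_prod_automorphisms K (L := F) b
  have h1 : algebraMap K (AlgebraicClosure K) (Algebra.norm K b) = ((algebraMap K F (Algebra.norm K b) : F) : AlgebraicClosure K) := by
    rw [IsScalarTower.algebraMap_apply K F (AlgebraicClosure K)]
    rfl
  rw [h1, hprod, IntermediateField.coe_prod]
  -- the map `y ↦ restriction of s y` is a bijection `Γ_K ⧸ Gal(K̄/F) → Gal(F/K)`
  let Θ : absoluteGaloisGroup K ⧸ galFixing K F → (F ≃ₐ[K] F) := fun y ↦ absRestrictNormalHom F (s y)
  have hker : ∀ σ : absoluteGaloisGroup K, absRestrictNormalHom F σ = 1 ↔ σ ∈ galFixing K F := fun σ ↦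
    (MonoidHom.mem_ker (f := AlgEquiv.restrictNormalHom F)).symm.trans
      (SetLike.ext_iff.mp (IntermediateField.restrictNormalHom_ker F) σ)
  have hΘ : Function.Bijective Θ := by
    constructor
    · intro y₁ y₂ h
      rw [← hs y₁, ← hs y₂, QuotientGroup.eq]
      apply (hker _).1
      rw [map_mul, map_inv, inv_mul_eq_one]
      exact h
    · intro τ
      obtain ⟨σ, hσ⟩ := AlgEquiv.restrictNormalHom_surjective (AlgebraicClosure K) τ
      let σ' : absoluteGaloisGroup K := σ
      refine ⟨(σ' : absoluteGaloisGroup K ⧸ galFixing K F), ?_⟩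
      have hmem : (s σ')⁻¹ * σ' ∈ galFixing K F := by rw [← QuotientGroup.eq, hs]
      have h2 := (hker _).2 hmem
      rw [map_mul, map_inv, inv_mul_eq_one] at h2
      change absRestrictNormalHom F (s σ') = τ
      rw [h2]
      exact hσ
  rw [← (Equiv.ofBijective Θ hΘ).prod_comp (fun τ : F ≃ₐ[K] F ↦ ((τ b : F) : AlgebraicClosure K))]
  refine Finset.prod_congr rfl fun y _ ↦ ?_
  change (s y) • (b : AlgebraicClosure K) = (((absRestrictNormalHom F (s y)) b : F) : AlgebraicClosure K)
  exact (AlgEquiv.restrictNormal_commutes (s y) F b).symm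

end Norm

/-! ## §4. The Kummer reading: `e_* (c^D)_* Ψ_* Sh[φ]` is the Kummer class of `N_{F/K}(b)` -/

section Kummer

variable {K : Type} [Field K] [NumberField K]
  {M : Type} [AddCommGroup M] [TopologicalSpace M] [DiscreteTopology M] [Finite M] (ρ : DiscreteGaloisModule K M)
  {M' : Type} [AddCommGroup M'] [DistribMulAction (absoluteGaloisGroup K) M'] [TopologicalSpace M'] [DiscreteTopology M']
  (hM' : ∀ m : M', IsOpen {σ : absoluteGaloisGroup K | σ • m = m})
  {n : ℕ} [NeZero n] (B : M →+ M' →+ MuCarrier K n)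
  (hB : ∀ (σ : absoluteGaloisGroup K) (m : M) (m' : M'), B (ρ σ m) (ofSMul M' hM' σ m') = mu K n σ (B m m'))
  (F : IntermediateField K (AlgebraicClosure K)) [FiniteDimensional K F] [IsGalois K F]
  (hU : IsOpen (galFixing K F : Set (absoluteGaloisGroup K)))
  [Fintype (absoluteGaloisGroup K ⧸ galFixing K F)]
  {s : absoluteGaloisGroup K ⧸ galFixing K F → absoluteGaloisGroup K}
  (hs : ∀ y, (s y : absoluteGaloisGroup K ⧸ galFixing K F) = y) (hs1 : s ((1 : absoluteGaloisGroup K) : absoluteGaloisGroup K ⧸ galFixing K F) = 1)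
  {m₀ : M} (hm₀ : ∀ σ : absoluteGaloisGroup K, ρ σ m₀ = m₀)

omit [NumberField K] [NeZero n] in
/-- `muVal` turns finite sums into products. [folklore] -/
theorem muVal_sum {ι : Type*} (t : Finset ι) (f : ι → MuCarrier K n) :
    muVal K n (∑ i ∈ t, f i) = ∏ i ∈ t, muVal K n (f i) := by
  classical
  induction t using Finset.induction_on with
  | empty => rw [Finset.sum_empty, Finset.prod_empty, muVal_zero]
  | insert a t ha ih => rw [Finset.sum_insert ha, Finset.prod_insert ha, muVal_add, ih]

omit [NumberField K] [Finite M] [NeZero n] in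
include hB hm₀ in
/-- `B(m₀, ·)` is `Γ_K`-equivariant into `μₙ` when `m₀` is `Γ_K`-fixed. [cite: MilneADT2006, Ch. I §0] -/
theorem muVal_B_smul (σ : absoluteGaloisGroup K) (m' : M') : muVal K n (B m₀ (σ • m')) = σ • muVal K n (B m₀ m') := by
  have h := hB σ m₀ m'
  rw [hm₀, ofSMul_apply_apply] at h
  rw [h, muVal_apply]

omit [NumberField K] [NeZero n] in
include hs in
/-- **Claim C: `(∏_y s(y) • β)ⁿ = N_{F/K}(b)`** for `βⁿ = b ∈ F` (orbit product = norm). [cite: NeukirchANT1999, Ch. IV §1] -/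
theorem prod_smul_pow_eq_unitsMap_norm (β : (AlgebraicClosure K)ˣ) (b : F)
    (hb : ((b : F) : AlgebraicClosure K) = ((β ^ n : (AlgebraicClosure K)ˣ) : AlgebraicClosure K)) (hb0 : Algebra.norm K b ≠ 0) :
    (∏ y : absoluteGaloisGroup K ⧸ galFixing K F, (s y) • β) ^ n =
      Units.map (algebraMap K (AlgebraicClosure K) : K →* AlgebraicClosure K) (Units.mk0 (Algebra.norm K b) hb0) := by
  ext
  rw [Units.val_pow_eq_pow_val, Units.coe_prod, ← Finset.prod_pow, Units.coe_map, MonoidHom.coe_coe, Units.val_mk0,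
    ← prod_smul_eq_algebraMap_norm F hs b, hb]
  refine Finset.prod_congr rfl fun y _ ↦ ?_
  rw [Units.coe_smul, ← smul_pow', ← Units.val_pow_eq_pow_val]

include hs hm₀ in
/-- **THE KUMMER READING OF THE CORESTRICTED DUAL-SHAPIRO CLASS.** Let `ρ` be a finite discrete `Γ_K`-module, `M′` a discrete `Γ_K`-module
with an equivariant pairing `B : M × M′ → μₙ`, `m₀ ∈ M` a `Γ_K`-FIXED element, `ρ₁` the trivial module `ℤ/n` with the constants map
`c : ℤ/n → Maps(Γ_K ⧸ U, M)` at `m₀` (`c 1 = const_{m₀}`, §2) and `e : (ℤ/n)^D → μₙ` the evaluation at `1`; `U = Gal(K̄/F)`, `F/K` finite Galois,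
`s` representatives. For a layer cocycle `φ : U → M′` whose image under `B(m₀, ·) : M′ → μₙ ⊆ K̄ˣ` is the Kummer cocycle of `β`
(`B(m₀, φ u) = uβ/β`, `βⁿ = b ∈ F`): **`H¹(e) H¹(c^D) H¹(Ψ) Sh[φ] = κₙ(N_{F/K} b)`** in `H¹(K, μₙ)` — on cocycles
`g ↦ Σ_y B(m₀, s_y • φ(s_{y}⁻¹ g s_{g⁻¹y})) = g(Nβ)/Nβ` with `Nβ = ∏_y s_y β`, `(Nβ)ⁿ = N_{F/K}(b)` (the fibre sum of the Shapiro lift is the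
transfer, `sum_shapiroCocycle_apply`; the Kummer class only depends on the `n`-th power, `kummerClassHom_eq_of_pow_eq`).
[cite: NeukirchSchmidtWingberg2008, I §5 Prop. (1.5.3)(iv), I §6 Prop. (1.6.4)] [cite: SerreLocalFields1979, VII §6–§7, X §3 b)] -/
theorem map_eval_tateDualComap_dualShapiro_eq_kummerMap_norm (ρ₁ : DiscreteGaloisModule K (ZMod n))
    (c : ρ₁.toContRepresentation →ⁱL (ρ.coind (galFixing K F) hU).toContRepresentation) (hc : ∀ y, c 1 y = m₀)
    (e : (ρ₁.tateDual n).toContRepresentation →ⁱL (mu K n).toContRepresentation) (he : ∀ f, e f = f 1)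
    (φ : contOneCocycles (discreteTopRep (galFixing K F) M'))
    (β : (AlgebraicClosure K)ˣ) (hβ : ∀ u : galFixing K F, muVal K n (B m₀ (φ.1 u)) = (u : absoluteGaloisGroup K) • β / β)
    (b : F) (hb : ((b : F) : AlgebraicClosure K) = ((β ^ n : (AlgebraicClosure K)ˣ) : AlgebraicClosure K))
    (hb0 : Algebra.norm K b ≠ 0) :
    galoisCohomology.map e 1 (galoisCohomology.map (tateDualComap c) 1
      (cohomologyMap (coindTateDualMor ρ (ofSMul M' hM') (galFixing K F) B hU hB) 1
        (shapiroLift (ofSMul M' hM').toTopRep (galFixing K F) hU hs hs1 (oneCocycleClass _ φ)))) =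
      Multiplicative.toAdd (kummerMap K n (Units.mk0 (Algebra.norm K b) hb0)) := by
  -- the norm root `Nβ = ∏_y s_y β`, a Kummer unit with `(Nβ)ⁿ = N(b)`
  have hC := prod_smul_pow_eq_unitsMap_norm (n := n) F hs β b hb hb0
  let αN : kummerUnits K n := ⟨∏ y : absoluteGaloisGroup K ⧸ galFixing K F, (s y) • β, fun σ ↦ by
    rw [hC]
    ext
    rw [Units.coe_smul, Units.coe_map, MonoidHom.coe_coe, smul_algebraMap]⟩
  have hroot : ((kummerUnitsRoot K n (Units.mk0 (Algebra.norm K b) hb0) : kummerUnits K n) : (AlgebraicClosure K)ˣ) ^ n =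
      ((αN : kummerUnits K n) : (AlgebraicClosure K)ˣ) ^ n := by
    rw [kummerUnitsRoot_pow]
    exact hC.symm
  rw [shapiroLift_oneCocycleClass, cohomologyMap_oneCocycleClass, galoisCohomology.map_one_oneCocycleClass,
    galoisCohomology.map_one_oneCocycleClass, kummerMap_apply, kummerClassHom_eq_of_pow_eq K n hroot, kummerClassHom_apply, toAdd_ofAdd]
  congr 1
  refine Subtype.ext (ContinuousMap.ext fun g ↦ muVal_injective K n ?_)
  -- both sides at `g`, through `muVal`
  rw [kummerOneCocycle_apply, muVal_kummerOneCocycleFun, contOneCocycles.pullback_apply, contOneCocycles.pullback_apply,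
    contOneCocycles.pullback_apply]
  change muVal K n (e (tateDualComap c (coindTateDualHom (galFixing K F) B
    ((shapiroCocycle (ofSMul M' hM').toTopRep (galFixing K F) hU hs φ).1 g)))) = _
  rw [he, tateDualComap_apply_apply, DiscreteGaloisModule.coindTateDualHom_apply_apply, muVal_sum]
  -- factorwise: `B(m₀, s_y • φ(sch)) ↦ g(s_{g⁻¹y} β) / s_y β`
  have key : ∀ y : absoluteGaloisGroup K ⧸ galFixing K F,
      muVal K n (B (c 1 y) ((shapiroCocycle (ofSMul M' hM').toTopRep (galFixing K F) hU hs φ).1 g y)) =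
        g • ((s (g⁻¹ • y)) • β) / ((s y) • β) := by
    intro y
    rw [hc, shapiroCocycle_apply]
    change muVal K n (B m₀ ((s y) • φ.1 (schreierElt (galFixing K F) hs g (g⁻¹ • y)))) = _
    rw [muVal_B_smul ρ hM' B hB hm₀, hβ, schreierElt_coe, smul_inv_smul, smul_div', ← mul_smul, ← mul_smul, mul_assoc (s y)⁻¹,
      mul_inv_cancel_left]
  rw [Finset.prod_congr rfl fun y _ ↦ key y, Finset.prod_div_distrib, ← Finset.smul_prod']
  -- reindex `y ↦ g⁻¹ • y`
  change g • (∏ x, s (g⁻¹ • x) • β) / (∏ y, s y • β) = g • (∏ y, s y • β) / (∏ y, s y • β)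
  rw [Fintype.prod_equiv (MulAction.toPerm g⁻¹) (fun x ↦ s (g⁻¹ • x) • β) (fun y ↦ s y • β) (fun _ ↦ rfl)]

omit [NumberField K] [NeZero n] [IsGalois K F] [Fintype (absoluteGaloisGroup K ⧸ galFixing K F)] in
/-- `b ≠ 0`, hence `N_{F/K}(b) ≠ 0`, when `b = βⁿ` for a unit `β`. [folklore] -/
theorem norm_ne_zero_of_eq_pow {β : (AlgebraicClosure K)ˣ} {b : F}
    (hb : ((b : F) : AlgebraicClosure K) = ((β ^ n : (AlgebraicClosure K)ˣ) : AlgebraicClosure K)) : Algebra.norm K b ≠ 0 := by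
  refine Algebra.norm_ne_zero_iff.mpr fun h0 ↦ ?_
  rw [h0] at hb
  exact (β ^ n).ne_zero (hb.symm.trans (ZeroMemClass.coe_zero F))

include hs hm₀ in
/-- **B5-U, STEP ONE: the `v̄`-condition of the dual-Shapiro class forces `n ∣ ord_v̄ (N_{F/K} b)`.** Setting of
`map_eval_tateDualComap_dualShapiro_eq_kummerMap_norm` (`n • m₀ = 0`). IF the localisation at `v̄` of the dual-Shapiro class `H¹(Ψ) Sh[φ]`
lies in the canonical dual local condition of `H¹_ur(K_v̄, Maps(Γ_K ⧸ U, M))` (clause (iii) of -w8 g5's `dualPullback_eq_zero_of_layerProNull`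
at `v̄`, VERBATIM), THEN `(n : ℤ) ∣ log v_v̄(N_{F/K}(b))`: pull the condition back along the constants `c` (§1–§2) to the trivial module `ℤ/n`
over the BASE `K`, read the pulled-back class as `κₙ(N_{F/K} b)` (§4), and apply (K-ū) at the base
(`KummerProNull.dvd_log_valuation_of_mem_dualLocalCondition_unramifiedSubgroup`, -w7 g6 p701967). No local invariant on an open subgroup of
`Γ_{K_v̄}` is needed. [cite: SerreLocalFields1979, XIV §1 Prop. 3] [cite: NeukirchSchmidtWingberg2008, I §5 Prop. (1.5.3)(iv)]
[cite: MilneADT2006, Ch. I §2 (Thm. 2.6)] -/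
theorem dvd_log_valuation_norm_of_dualShapiro_mem (hn0 : n • m₀ = 0) (vbar : HeightOneSpectrum (𝓞 K))
    (φ : contOneCocycles (discreteTopRep (galFixing K F) M'))
    (hvbar : galoisCohomology.localization ((ρ.coind (galFixing K F) hU).tateDual n) (Sum.inr vbar) 1
        (cohomologyMap (coindTateDualMor ρ (ofSMul M' hM') (galFixing K F) B hU hB) 1
          (shapiroLift (ofSMul M' hM').toTopRep (galFixing K F) hU hs hs1 (oneCocycleClass _ φ))) ∈
      (LocalInvariants.canonical K n).dualLocalCondition (ρ.coind (galFixing K F) hU) (Sum.inr vbar)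
        (unramifiedSubgroup (GaloisRep.toLocal vbar (ρ.coind (galFixing K F) hU)) 1))
    (β : (AlgebraicClosure K)ˣ) (hβ : ∀ u : galFixing K F, muVal K n (B m₀ (φ.1 u)) = (u : absoluteGaloisGroup K) • β / β)
    (b : F) (hb : ((b : F) : AlgebraicClosure K) = ((β ^ n : (AlgebraicClosure K)ˣ) : AlgebraicClosure K)) :
    (n : ℤ) ∣ WithZero.log (vbar.valuation K (Algebra.norm K (b : F))) := by
  let ρ₁ : DiscreteGaloisModule K (ZMod n) := ContinuousRep.trivial (absoluteGaloisGroup K) ℤ (ZMod n)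
  have hρ₁ : ∀ (σ : absoluteGaloisGroup K) (k : ZMod n), ρ₁ σ k = k := fun _ _ ↦ rfl
  obtain ⟨c, hc⟩ := exists_constIntertwining ρ (galFixing K F) hU ρ₁ hρ₁ m₀ hm₀ hn0
  obtain ⟨e, he⟩ := KummerProNull.exists_contIntertwiningMap_tateDual_eval ρ₁ hρ₁
  have hb0 := norm_ne_zero_of_eq_pow (n := n) F hb
  have h1 := localMap_tateDualComap_mem_dualLocalCondition_unramified c (LocalInvariants.canonical K n) vbar hvbar
  have h2 : galoisCohomology.localization (ρ₁.tateDual n) (Sum.inr vbar) 1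
      (galoisCohomology.map (tateDualComap c) 1
        (cohomologyMap (coindTateDualMor ρ (ofSMul M' hM') (galFixing K F) B hU hB) 1
          (shapiroLift (ofSMul M' hM').toTopRep (galFixing K F) hU hs hs1 (oneCocycleClass _ φ)))) ∈
      (LocalInvariants.canonical K n).dualLocalCondition ρ₁ (Sum.inr vbar) (unramifiedSubgroup (GaloisRep.toLocal vbar ρ₁) 1) := by
    rw [localization_map_one_eq]
    exact h1
  have h3 := KummerProNull.dvd_log_valuation_of_mem_dualLocalCondition_unramifiedSubgroup K ρ₁ hρ₁ e he vbar
    (Units.mk0 (Algebra.norm K b) hb0) _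
    (map_eval_tateDualComap_dualShapiro_eq_kummerMap_norm ρ hM' B hB F hU hs hs1 hm₀ ρ₁ c hc e he φ β hβ b hb hb0) h2
  rwa [Units.val_mk0] at h3

end Kummer

end Summit.BirchSwinnertonDyer.BirchSwinnertonDyer.Theorems.PrintCf2.NormAtVbar

end
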